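import Summits.NavierStokesRegularity.FluidComputer.PalasekTowerClayBridge
import Summits.NavierStokesRegularity.FluidComputer.PalasekTowerClayBridgeRates
import Summits.NavierStokesRegularity.FluidComputer.ClayForcedLerayHopf
import Literature.Analysis.FluidPDE.TaoForcedFiniteEnergyLerayHopfAE
import HarnessLib

/-!
# The E–C bridge by WEAK–STRONG uniqueness (PATH B): `Realisation ν R ⇒ NavierStokesBreakdownR3`
# modulo Sohr V.1.5.1 and Tao's forced Lemma 4.1 (i) ONLY — without unconditional uniqueness

HONEST FRAMING (cell `ns-blowup`, seat `ns-blowup-ecbridge-2` g2, human ruling D-0035; planner WORD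
STATUS l.1312 «PATH B ADOPTED … bridge variant `navierStokesBreakdownR3_of_realisation_ws` … after which r9
is dropped as not load-bearing»). WHAT THIS IS NOT: not NS — no construction; the crux `PalasekStep2`
stays a hypothesis; this file only replaces the W14 slot `tao_unconditional_uniqueness_velocity_forced`
(Tao Cor. 11.4 WITH force, arXiv Remark 72: open for smooth finite-energy data) of the bridge
`navierStokesBreakdownR3_of_step2` by the TWO PRINTED forced facts

* `hSM : sohr2001_serrinMasuda_uniqueness_forced` — Sohr 2001 Thm. V.1.5.1 (Serrin, Masuda),
* `hP : tao2011_forced_pressure_normalisation_ae` — Tao 2011 Lemma 4.1 (i) WITH force in its CORRECTED a.e. form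
  (p411897; the verbatim «C bounded» rendering is refuted in the tree, `not_tao2011_forced_pressure_normalisation`),

each typed in the tree as a named fact with its `f = 0` twin PROVED (`weak_strong_uniqueness_holds`,
`tao_pressure_normalisation_holds` ⇒ `…_ae.force_zero_of_homogeneous`). (Tao's forced Lemma 8.1 `tao2011_forced_finiteEnergy_energyBound` is
NOT needed: its one use — finiteness of the dissipation of a finite-energy classical solution — is the
theorem `IsClassicalNSSolutionOn.lintegral_gradient_lt_top_forced` of
`TaoForcedFiniteEnergyLerayHopfAE.lean`, proved from `hP`.)

Why weak–strong suffices (LIT-DOSSIER §41 (D)): the designed solution of a `Realisation` is CLASSICAL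
on `[0, T)` with finite energy on closed sub-slabs and, by the interface's velocity CEILINGS
`|u(t,x)| ≤ c₂ Y_k` for `t ≤ τ_k` together with the Palasek clock `T - τ_{k+1} ≤ c₃/A_k → 0`, BOUNDED
on every `[0, T'] × ℝ³`, `T' < T`; bounded + finite energy ⇒ `u ∈ L⁴(0,T'; L⁶)` (the Serrin pair
`3/6 + 2/4 = 1`; `∫|u|⁶ ≤ ‖u‖_∞⁴ ∫|u|²`); a Clay competitor `(v, q)` from the same datum is Leray–Hopf
on every `[0, T')` (`isGlobalLerayHopf_of_claySolution'`), the designed solution is Leray–Hopf there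
too (`isLerayHopfOn_of_clayForce'`), and Serrin–Masuda identifies them
(`clay_competitor_eq_of_serrinClass'`) — primed = the `hL`-free forms of the `ClayForcedLerayHopf`
theorems (whose verbatim-`hP` forms are vacuous), through `isLerayHopfOn_of_finiteEnergy_forced_ae`. The floors then forbid the competitor's
continuity on the box `[0,T] × B̄(0, radius)` exactly as before (`Realisation.false_of_continuousOn_box`).

* `isLerayHopfOn_of_clayForce'`, `isGlobalLerayHopf_of_claySolution'`,
  `clay_competitor_eq_of_serrinClass'` — the Clay packaging conditional on `hP` (and `hSM`) only;
* `memLqLp_four_six_of_bounded` — bounded + finite-energy continuous slices ⇒ `L⁴(0,T';L⁶)`;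
* `Realisation.exists_τ_ge`, `Realisation.norm_le_of_lt` — the clock exhausts `[0, T)`
  (`Realisation.tendsto_τ` of `PalasekTowerClayBridgeRates`); a uniform
  velocity bound on every `[0, T']`, `T' < T`;
* `Realisation.eq_of_claySolution_ws`, `Realisation.not_exists_claySolution_ws`;
* `navierStokesBreakdownR3_of_step2_ws : hSM → hP → PalasekStep2 R → NavierStokesBreakdownR3`
  (+ the Literature spelling, + the one-realisation form).
-/

noncomputable section

namespace Summit.NavierStokesRegularity.FluidComputer.PalasekTowerClayBridge

open Set MeasureTheory Filter Topology Function
open scoped ENNReal ContDiff NNReal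
open Literature.Analysis.FluidPDE
open Summit.NavierStokesRegularity.NavierStokesRegularity
open Summit.NavierStokesRegularity.FluidComputer.ClayForcedLerayHopf

/-! ## The Clay packaging, conditional on the forced pressure normalisation only -/

section Clay

/-- **Finite-energy classical solutions of forced Navier–Stokes with a Clay-class force are
Leray–Hopf — given the forced pressure normalisation `hP` only** (slab by slab; energy equality
with the work term; `u ∈ C([0,T];L²)`). The `hL`-free form of `ClayForcedLerayHopf.isLerayHopfOn_of_clayForce`. -/
theorem isLerayHopfOn_of_clayForce'
    {T ν : ℝ} {f u : ℝ → EuclideanSpace ℝ (Fin 3) → EuclideanSpace ℝ (Fin 3)}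
    {p : ℝ → EuclideanSpace ℝ (Fin 3) → ℝ}
    (hP : tao2011_forced_pressure_normalisation_ae)
    (h : IsClassicalNSSolutionOn (Icc 0 T) ν f u p) (hν : 0 < ν) (hT : 0 < T)
    (hs : IsSmoothOnHalfSpace f) (hd : HasRapidSpaceTimeDecay f)
    (hfe : ∃ A : ℝ≥0∞, A < ⊤ ∧ ∀ t ∈ Icc 0 T, ∫⁻ x, ‖u t x‖ₑ ^ 2 ≤ A) :
    IsLerayHopfOn T ν f (u 0) u ∧ ContinuousInLpOn (Icc 0 T) 2 u := by
  obtain ⟨⟨C₀, hC₀⟩, -⟩ := ClayForceSliceBounds.clayForce_slice_bounds hs hd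
  obtain ⟨Pf, hPft, hPf⟩ := clayForce_forcePotential_bounds hs hd
  exact h.isLerayHopfOn_of_finiteEnergy_forced_ae hP hν hT (Cf := (C₀ : ℝ≥0∞))
    ENNReal.coe_ne_top (fun t ht => hC₀ t ht.1) hPft.ne (fun t ht => (hPf t ht.1).1)
    (fun t ht => (hPf t ht.1).2) hfe

/-- **A Clay solution on `[0, ∞)` is a global Leray–Hopf solution — given `hP` only**: for
`ν > 0`, a Clay-class force `f`, and `(u, p)` smooth on `[0,∞) × ℝ³` solving Fefferman's (1)–(3)
from `u₀` with bounded energy (7), `u` is Leray–Hopf on every `[0, T)` from `u₀` WITH force `f`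
(the competitor input `hu` of `sohr2001_serrinMasuda_uniqueness_forced`). -/
theorem isGlobalLerayHopf_of_claySolution'
    {ν : ℝ} {f u : ℝ → EuclideanSpace ℝ (Fin 3) → EuclideanSpace ℝ (Fin 3)}
    {u₀ : EuclideanSpace ℝ (Fin 3) → EuclideanSpace ℝ (Fin 3)} {p : ℝ → EuclideanSpace ℝ (Fin 3) → ℝ}
    (hP : tao2011_forced_pressure_normalisation_ae)
    (hν : 0 < ν) (hs : IsSmoothOnHalfSpace f) (hd : HasRapidSpaceTimeDecay f)
    (hsol : IsNavierStokesSolution ν f u₀ u p) (hu : IsSmoothOnHalfSpace u)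
    (hp : IsSmoothOnHalfSpace p) (hE : HasBoundedEnergy u) :
    IsGlobalLerayHopf ν f u₀ u ∧ ∀ T, 0 < T → ContinuousInLpOn (Icc 0 T) 2 u := by
  obtain ⟨hcl, h0⟩ := isNavierStokesSolution_and_smooth_iff.1 ⟨hsol, hu, hp⟩
  obtain ⟨A, hAt, hA⟩ := hE
  have key : ∀ T, 0 < T → IsLerayHopfOn T ν f u₀ u ∧ ContinuousInLpOn (Icc 0 T) 2 u := by
    intro T hT
    have hT' : IsClassicalNSSolutionOn (Icc 0 T) ν f u p :=
      hcl.mono Icc_subset_Ici_self (uniqueDiffOn_Icc hT)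
    have hfe : ∃ A : ℝ≥0∞, A < ⊤ ∧ ∀ t ∈ Icc 0 T, ∫⁻ x, ‖u t x‖ₑ ^ 2 ≤ A :=
      ⟨A, hAt, fun t ht => hA t ht.1⟩
    rw [← h0]
    exact isLerayHopfOn_of_clayForce' hP hT' hν hT hs hd hfe
  exact ⟨fun T hT => (key T hT).1, fun T hT => (key T hT).2⟩

/-- **THE PATH B CLOSING LEMMA (generic form), given `hSM` and `hP` only.** Let `f` be a Clay-class
force, `(w, q)` a classical solution of the forced system on the closed slab `[0, T] × ℝ³` with
`sup_t ∫|w(t)|² < ∞` lying in `L⁴(0,T'; L⁶)` for every `T' < T` (the DESIGNED solution), and `(v, r)`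
ANY Clay solution on `[0, ∞)` (Fefferman (1)–(3), (6)–(7)) from the same datum `w 0`. Then `v = w` on
`[0, T] × ℝ³` (Serrin–Masuda between two Leray–Hopf solutions; continuity upgrades a.e. to
everywhere and reaches the endpoints). -/
theorem clay_competitor_eq_of_serrinClass'
    {ν T : ℝ} {f w v : ℝ → EuclideanSpace ℝ (Fin 3) → EuclideanSpace ℝ (Fin 3)}
    {q r : ℝ → EuclideanSpace ℝ (Fin 3) → ℝ}
    (hSM : sohr2001_serrinMasuda_uniqueness_forced) (hP : tao2011_forced_pressure_normalisation_ae)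
    (hν : 0 < ν) (hT : 0 < T) (hs : IsSmoothOnHalfSpace f) (hd : HasRapidSpaceTimeDecay f)
    (hw : IsClassicalNSSolutionOn (Icc 0 T) ν f w q)
    (hwE : ∃ A : ℝ≥0∞, A < ⊤ ∧ ∀ t ∈ Icc 0 T, ∫⁻ x, ‖w t x‖ₑ ^ 2 ≤ A)
    (hS : ∀ T', 0 < T' → T' < T → MemLqLp 4 6 w (Ioo 0 T'))
    (hsol : IsNavierStokesSolution ν f (w 0) v r) (hv : IsSmoothOnHalfSpace v)
    (hr : IsSmoothOnHalfSpace r) (hvE : HasBoundedEnergy v) :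
    ∀ t ∈ Icc 0 T, v t = w t := by
  have hLHv : IsLerayHopfOn T ν f (w 0) v :=
    (isGlobalLerayHopf_of_claySolution' hP hν hs hd hsol hv hr hvE).1 T hT
  have hLHw : IsLerayHopfOn T ν f (w 0) w := (isLerayHopfOn_of_clayForce' hP hw hν hT hs hd hwE).1
  have hf : ∀ T', 0 < T' → T' < T → MemLqLp 1 2 f (Ioo 0 T') :=
    fun T' _ _ => clayForce_memLqLp_one_two hs hd T'
  have hae : ∀ t ∈ Ioo 0 T, w t =ᵐ[volume] v t := hSM.of_L4L6 hν hT hf hLHv hLHw hS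
  obtain ⟨hcl, -⟩ := isNavierStokesSolution_and_smooth_iff.1 ⟨hsol, hv, hr⟩
  have hvT : IsClassicalNSSolutionOn (Icc 0 T) ν f v r :=
    hcl.mono Icc_subset_Ici_self (uniqueDiffOn_Icc hT)
  have hIoo : ∀ t ∈ Ioo 0 T, v t = w t := by
    intro t ht
    have htI : t ∈ Icc 0 T := Ioo_subset_Icc_self ht
    exact ((Continuous.ae_eq_iff_eq volume (hvT.contDiff_velocity htI).continuous
      (hw.contDiff_velocity htI).continuous).1 (hae t ht).symm)
  intro t ht
  funext x
  have hcv : ContinuousOn (fun s => v s x) (Icc 0 T) :=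
    hvT.smooth_velocity.continuousOn.comp ((continuous_id.prodMk continuous_const).continuousOn)
      fun s hs => mk_mem_prod hs (mem_univ x)
  have hcw : ContinuousOn (fun s => w s x) (Icc 0 T) :=
    hw.smooth_velocity.continuousOn.comp ((continuous_id.prodMk continuous_const).continuousOn)
      fun s hs => mk_mem_prod hs (mem_univ x)
  have hEq : EqOn (fun s => v s x) (fun s => w s x) (Ioo 0 T) := fun s hs => by
    simp only [hIoo s hs]
  have hcl' : Icc 0 T ⊆ closure (Ioo 0 T) := by rw [closure_Ioo hT.ne]
  exact hEq.of_subset_closure hcv hcw Ioo_subset_Icc_self hcl' ht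

end Clay

/-! ## Bounded finite-energy fields are in the Serrin class `L⁴(0,T';L⁶)` -/

/-- `∫ |w|⁶ ≤ B⁴ ∫ |w|²` for `|w| ≤ B`, in `ℝ≥0∞`. [folklore] -/
theorem lintegral_enorm_pow_six_le {w : EuclideanSpace ℝ (Fin 3) → EuclideanSpace ℝ (Fin 3)}
    {B : ℝ} (hB : ∀ x, ‖w x‖ ≤ B) :
    ∫⁻ x, ‖w x‖ₑ ^ 6 ≤ ENNReal.ofReal (B ^ 4) * ∫⁻ x, ‖w x‖ₑ ^ 2 := by
  rw [← lintegral_const_mul' _ _ ENNReal.ofReal_ne_top]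
  refine lintegral_mono fun x => ?_
  have hB0 : 0 ≤ B := (norm_nonneg _).trans (hB x)
  have e : ‖w x‖ₑ ^ 6 = ‖w x‖ₑ ^ 4 * ‖w x‖ₑ ^ 2 := by rw [← pow_add]
  rw [e]
  gcongr
  rw [← ofReal_norm, ← ENNReal.ofReal_pow (norm_nonneg _)]
  exact ENNReal.ofReal_le_ofReal (pow_le_pow_left₀ (norm_nonneg _) (hB x) 4)

/-- **Bounded continuous fields of finite energy on `[0, T']` lie in `L⁴(0, T'; L⁶(ℝ³))`** — the
Serrin class `3/6 + 2/4 = 1` through `‖w‖₆ ≤ ‖w‖_∞^{2/3} ‖w‖₂^{1/3}` (here: `∫|w|⁶ ≤ B⁴ A`, so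
`t ↦ ‖w(t)‖₆` is bounded on a finite interval). -/
theorem memLqLp_four_six_of_bounded
    {w : ℝ → EuclideanSpace ℝ (Fin 3) → EuclideanSpace ℝ (Fin 3)} {T' : ℝ}
    (hc : ∀ t ∈ Icc 0 T', Continuous (w t)) {B : ℝ} (hB : ∀ t ∈ Icc 0 T', ∀ x, ‖w t x‖ ≤ B)
    {A : ℝ≥0∞} (hAt : A ≠ ⊤) (hA : ∀ t ∈ Icc 0 T', ∫⁻ x, ‖w t x‖ₑ ^ 2 ≤ A) :
    MemLqLp 4 6 w (Ioo 0 T') := by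
  set S : ℝ≥0∞ := ENNReal.ofReal (B ^ 4) * A with hS
  have hSt : S ≠ ⊤ := ENNReal.mul_ne_top ENNReal.ofReal_ne_top hAt
  have h6 : ∀ t ∈ Icc 0 T', ∫⁻ x, ‖w t x‖ₑ ^ 6 ≤ S := fun t ht =>
    (lintegral_enorm_pow_six_le (hB t ht)).trans (by rw [hS]; gcongr; exact hA t ht)
  have hnorm : ∀ t ∈ Icc 0 T', eLpNorm (w t) 6 volume = (∫⁻ x, ‖w t x‖ₑ ^ 6) ^ (1 / 6 : ℝ) := by
    intro t _
    rw [eLpNorm_eq_lintegral_rpow_enorm_toReal (by norm_num) (by norm_num)]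
    have h6r : (6 : ℝ≥0∞).toReal = 6 := by norm_num
    rw [h6r]
    congr 1
    refine lintegral_congr fun x => ?_
    rw [show (6 : ℝ) = ((6 : ℕ) : ℝ) by norm_num, ENNReal.rpow_natCast]
  have hmem : ∀ t ∈ Icc 0 T', MemLp (w t) 6 volume := by
    intro t ht
    refine ⟨(hc t ht).aestronglyMeasurable, ?_⟩
    rw [hnorm t ht]
    exact ENNReal.rpow_lt_top_of_nonneg (by norm_num) ((h6 t ht).trans_lt hSt.lt_top).ne
  refine ⟨(ae_restrict_iff' measurableSet_Ioo).2 (Eventually.of_forall fun t ht =>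
    hmem t (Ioo_subset_Icc_self ht)), ?_⟩
  -- the mixed norm: `‖w(t)‖₆ ≤ S^{1/6}` on a finite interval
  rw [eLqLpNorm]
  have hb : ∀ᵐ t ∂(volume.restrict (Ioo 0 T')), ‖(eLpNorm (w t) 6 volume).toReal‖ ≤
      (S ^ (1 / 6 : ℝ)).toReal := by
    refine (ae_restrict_iff' measurableSet_Ioo).2 (Eventually.of_forall fun t ht => ?_)
    rw [Real.norm_of_nonneg ENNReal.toReal_nonneg]
    refine ENNReal.toReal_mono (ENNReal.rpow_ne_top_of_nonneg (by norm_num) hSt) ?_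
    rw [hnorm t (Ioo_subset_Icc_self ht)]
    gcongr
    exact h6 t (Ioo_subset_Icc_self ht)
  refine (eLpNorm_le_of_ae_bound hb).trans_lt ?_
  refine ENNReal.mul_lt_top (ENNReal.rpow_lt_top_of_nonneg (by positivity) ?_) ENNReal.ofReal_lt_top
  rw [Measure.restrict_apply_univ, Real.volume_Ioo]
  exact ENNReal.ofReal_ne_top

/-! ## The clock exhausts `[0, T)`; uniform bounds on closed sub-slabs -/

namespace Realisation

variable {ν : ℝ} {R : TowerRates} (W : Realisation ν R)

/-- **The readout times exhaust `[0, T)`**: for every `t < T` some readout time `τ k ≥ t` (the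
clock accumulates the readout times at `T`: `Realisation.tendsto_τ` of `…ClayBridgeRates`). -/
theorem exists_τ_ge {t : ℝ} (ht : t < W.T) : ∃ k, t ≤ W.τ k := by
  obtain ⟨k, hk⟩ := (W.tendsto_τ.eventually (eventually_gt_nhds ht)).exists
  exact ⟨k, hk.le⟩

/-- **Uniform velocity bound on every closed sub-slab**: for `T' < T` there is `B` with
`|u(t, x)| ≤ B` for all `t ∈ [0, T']`, `x` (the ceiling of a level whose readout time is `≥ T'`). -/
theorem norm_le_of_lt {T' : ℝ} (hT' : T' < W.T) :
    ∃ B : ℝ, ∀ t ∈ Icc 0 T', ∀ x, ‖W.u t x‖ ≤ B := by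
  obtain ⟨k, hk⟩ := W.exists_τ_ge hT'
  exact ⟨W.c₂ * R.Y k, fun t ht x => W.ceiling k t ⟨ht.1, ht.2.trans hk⟩ x⟩

/-- **The designed solution lies in `L⁴(0, T''; L⁶)` for every `T'' ≤ T' < T`** (bounded with
finite energy on `[0, T']`). -/
theorem memLqLp_four_six {T' : ℝ} (hT' : T' < W.T) {T'' : ℝ} (hT'' : T'' ≤ T') :
    MemLqLp 4 6 W.u (Ioo 0 T'') := by
  obtain ⟨B, hB⟩ := W.norm_le_of_lt hT'
  obtain ⟨A, hAt, hA⟩ := W.energy T' hT'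
  have hsub : Icc 0 T'' ⊆ Icc 0 T' := Icc_subset_Icc le_rfl hT''
  have hcl : IsClassicalNSSolutionOn (Ico 0 W.T) ν W.f W.u W.p := W.classical
  refine memLqLp_four_six_of_bounded (fun t ht => ?_) (fun t ht => hB t (hsub ht)) hAt.ne
    (fun t ht => hA t (hsub ht))
  exact (hcl.contDiff_velocity ⟨ht.1, lt_of_le_of_lt (ht.2.trans hT'') hT'⟩).continuous

/-- **Uniqueness against a global Clay-class solution — by WEAK–STRONG uniqueness (PATH B).**
Given the two printed forced facts `hSM`, `hP`, a solution `(v, q)` of the same forced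
system from the same datum, jointly smooth on `[0, ∞) × ℝ³` with bounded energy, coincides with
the tower on `[0, T)`: for `0 < t < T` apply `clay_competitor_eq_of_serrinClass` on the closed slab
`[0, t']`, `t < t' < T`, where the designed solution is classical, of finite energy and in
`L⁴(0,·;L⁶)` (`memLqLp_four_six`), via `clay_competitor_eq_of_serrinClass'`. -/
theorem eq_of_claySolution_ws (hSM : sohr2001_serrinMasuda_uniqueness_forced)
    (hP : tao2011_forced_pressure_normalisation_ae) (hν : 0 < ν) {v : ℝ → EuclideanSpace ℝ (Fin 3) → EuclideanSpace ℝ (Fin 3)}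
    {q : ℝ → EuclideanSpace ℝ (Fin 3) → ℝ}
    (hv : IsSmoothOnHalfSpace v) (hq : IsSmoothOnHalfSpace q)
    (hns : IsNavierStokesSolution ν W.f (W.u 0) v q) (hE : HasBoundedEnergy v) :
    ∀ t ∈ Ico 0 W.T, v t = W.u t := by
  intro t ht
  obtain ⟨ht0, htT⟩ := ht
  -- a closed slab `[0, t']` with `t < t' < T`
  obtain ⟨t', htt', ht'T⟩ := exists_between htT
  have ht'0 : 0 < t' := lt_of_le_of_lt ht0 htt'
  have hu' : IsClassicalNSSolutionOn (Icc 0 t') ν W.f W.u W.p :=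
    W.classical.mono (fun s hs => ⟨hs.1, lt_of_le_of_lt hs.2 ht'T⟩) (uniqueDiffOn_Icc ht'0)
  have hEu : ∃ C : ℝ≥0∞, C < ⊤ ∧ ∀ s ∈ Icc 0 t', ∫⁻ x, ‖W.u s x‖ₑ ^ 2 ≤ C := W.energy t' ht'T
  have hS : ∀ T', 0 < T' → T' < t' → MemLqLp 4 6 W.u (Ioo 0 T') :=
    fun T' _ hT' => W.memLqLp_four_six ht'T hT'.le
  exact clay_competitor_eq_of_serrinClass' hSM hP hν ht'0 W.force_smooth W.force_decay hu' hEu hS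
    hns hv hq hE t ⟨ht0, htt'.le⟩

/-- **No global Clay-class solution shares the tower's datum and force — PATH B form** (given
`hSM`, `hP`): such a solution would coincide with the tower on `[0, T)`
(`eq_of_claySolution_ws`), yet it is continuous on the compact box `[0, T] × B̄(0, radius)`, which
the floors forbid (`false_of_continuousOn_box`). -/
theorem not_exists_claySolution_ws (hSM : sohr2001_serrinMasuda_uniqueness_forced)
    (hP : tao2011_forced_pressure_normalisation_ae) (hν : 0 < ν) :
    ¬ ∃ (v : ℝ → EuclideanSpace ℝ (Fin 3) → EuclideanSpace ℝ (Fin 3))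
        (q : ℝ → EuclideanSpace ℝ (Fin 3) → ℝ),
        IsSmoothOnHalfSpace v ∧ IsSmoothOnHalfSpace q ∧
          IsNavierStokesSolution ν W.f (W.u 0) v q ∧ HasBoundedEnergy v := by
  rintro ⟨v, q, hv, hq, hns, hE⟩
  have heq : ∀ t ∈ Ico 0 W.T, v t = W.u t := W.eq_of_claySolution_ws hSM hP hν hv hq hns hE
  refine W.false_of_continuousOn_box (v := v) ?_ heq
  have hsub : Icc (0 : ℝ) W.T ×ˢ Metric.closedBall (0 : EuclideanSpace ℝ (Fin 3)) W.radius ⊆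
      Ici (0 : ℝ) ×ˢ (univ : Set (EuclideanSpace ℝ (Fin 3))) :=
    prod_mono (fun s hs => hs.1) (subset_univ _)
  exact (ContDiffOn.continuousOn hv).mono hsub

end Realisation

/-- **THE E–C BRIDGE, PATH B (weak–strong) FORM.** If Sohr's forced Serrin–Masuda theorem
(`sohr2001_serrinMasuda_uniqueness_forced`, Thm. V.1.5.1) and Tao's forced pressure normalisation
(`tao2011_forced_pressure_normalisation_ae`, Lemma 4.1 (i), corrected a.e. form) hold, and Palasek's Step 2 is
realised for the rates `R` at every viscosity (`PalasekStep2 R`), then Fefferman's breakdown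
statement (C) `NavierStokesBreakdownR3` holds. Conditional on ALL THREE hypotheses; none is asserted;
the first two are printed theorems (debts with a discharge plan = forced twins of PROVED `f = 0`
tree files), the third is the crux. -/
theorem navierStokesBreakdownR3_of_step2_ws (R : TowerRates)
    (hSM : sohr2001_serrinMasuda_uniqueness_forced) (hP : tao2011_forced_pressure_normalisation_ae)
    (h : PalasekStep2 R) :
    Summit.NavierStokesRegularity.NavierStokesRegularity.NavierStokesBreakdownR3 := by
  intro ν hν
  obtain ⟨W⟩ := h ν hν
  exact ⟨W.u 0, W.f, W.contDiff_datum, W.divFree_datum, W.datum_decay, W.force_smooth,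
    W.force_decay, W.not_exists_claySolution_ws hSM hP hν⟩

/-- **THE E–C BRIDGE, PATH B FORM, Literature spelling of (C).** -/
theorem literature_navierStokesBreakdownR3_of_step2_ws (R : TowerRates)
    (hSM : sohr2001_serrinMasuda_uniqueness_forced) (hP : tao2011_forced_pressure_normalisation_ae)
    (h : PalasekStep2 R) :
    Literature.Analysis.FluidPDE.NavierStokesBreakdownR3 :=
  navierStokesBreakdownR3_iff_literature.1 (navierStokesBreakdownR3_of_step2_ws R hSM hP h)

/-- **The realisation form** (no `PalasekStep2` quantifier): ONE realisation at viscosity `ν` already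
gives the `ν`-instance of (C) — a Schwartz-class datum and a Clay-class force admitting no global
smooth bounded-energy solution. -/
theorem navierStokesBreakdownR3_at_of_realisation_ws {ν : ℝ} {R : TowerRates} (W : Realisation ν R)
    (hSM : sohr2001_serrinMasuda_uniqueness_forced) (hP : tao2011_forced_pressure_normalisation_ae)
    (hν : 0 < ν) :
    ∃ (u₀ : EuclideanSpace ℝ (Fin 3) → EuclideanSpace ℝ (Fin 3))
      (f : ℝ → EuclideanSpace ℝ (Fin 3) → EuclideanSpace ℝ (Fin 3)),
      ContDiff ℝ ∞ u₀ ∧ NSWave0.IsDivFree u₀ ∧ HasRapidSpatialDecay u₀ ∧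
      IsSmoothOnHalfSpace f ∧ HasRapidSpaceTimeDecay f ∧
        ¬ ∃ (u : ℝ → EuclideanSpace ℝ (Fin 3) → EuclideanSpace ℝ (Fin 3))
            (p : ℝ → EuclideanSpace ℝ (Fin 3) → ℝ),
            IsSmoothOnHalfSpace u ∧ IsSmoothOnHalfSpace p ∧
              IsNavierStokesSolution ν f u₀ u p ∧ HasBoundedEnergy u :=
  ⟨W.u 0, W.f, W.contDiff_datum, W.divFree_datum, W.datum_decay, W.force_smooth, W.force_decay,
    W.not_exists_claySolution_ws hSM hP hν⟩

end Summit.NavierStokesRegularity.FluidComputer.PalasekTowerClayBridge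

end
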